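import Summits.FinalStateConjecture.FinalStateConjecture.Theorems.PhotonSphereChannelsTameCensorshipExactRegionDomain
import Literature.Geometry.Lorentzian.CauchyDevelopmentComap
import Literature.Geometry.Lorentzian.DataEmbeddingNormalSmooth
import Literature.Geometry.Lorentzian.DataEmbeddingOneJetPointwise
import Literature.Geometry.Lorentzian.CommonDevelopmentRigidity
import Literature.Geometry.Lorentzian.ExactKerrEnd
import Summits.FinalStateConjecture.FinalStateConjecture.Theses.ExactKerrEnds
import HarnessLib

/-!
# Route ExactKerrEnds, support item `ExactKerrFarDevelopment` (stmt-FinalStateConjecture-18523):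
# the exact-region chart of a development from a maximal development of the sub-datum —
# with leaf matching and injectivity

Core construction behind the conditional reduction of `ExactKerrFarDevelopment`: for a vacuum
Cauchy development `𝒟` of `D` on `X`, a smooth open embedding `φ : N → X` (injective
differentials, connected nonempty `N`, compact `(range φ)ᶜ`), a MAXIMAL vacuum Cauchy development
`𝒦` of the pulled-back datum `D.comap φ` and a smooth isometric immersion `ε : 𝒦 → 𝓣` into a
spacetime `𝓣`, the domain-of-dependence component `V ∋ ι(φ N)` of `𝒟` is open, contains the exact
region `J⁺(ιX) ∖ J⁺(ι (range φ)ᶜ)`, and `χ := ε ∘ ψ` (`ψ : (V, g|_V, ι ∘ φ) ↪ 𝒦` by maximality of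
`𝒦`) is smooth and isometric on `V`, time-orientation preserving when `ε` is, MATCHES THE LEAF
(`χ (ι (φ u)) = ε (ι_𝒦 u)`, since `ψ ∘ (ι ∘ φ) = ι_𝒦`) and is INJECTIVE on `V` when `ε` is
injective (`ψ` is an open embedding). The first five clauses are the construction of
`PhotonSphereChannels.TameCensorshipCrush.exactRegionCore_of_leafMaximal` (crux `TameCensorship`,
clause (B1) of stub B), whose proof is adapted here verbatim; the last two are what the support
item `ExactKerrFarDevelopment` of route `ExactKerrEnds` asks in addition (`χ ∘ ι ∘ φ = ψ_leaf` off
`K'`, `InjOn χ E'`).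

References: Choquet-Bruhat–Geroch, CMP 14 (1969), Thm. 3 and p. 332; Sbierski 2016 (AHP 17),
Def. 2.4–2.5; Hawking–Ellis 1973, §7.5–7.6.
-/

noncomputable section

-- The tree namespace `Summit.FinalStateConjecture.FinalStateConjecture.…` (summit = sub-problem)
-- repeats a component by design (D-0022), which the `dupNamespace` linter would flag on every decl.
set_option linter.dupNamespace false

open scoped Manifold ContDiff Topology
open Set Filter Function TopologicalSpace Topology Bundle
open Literature.Geometry.Lorentzian
open Summit.FinalStateConjecture.FinalStateConjecture.Theorems.PhotonSphereChannels.TameCensorshipCrush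

namespace Summit.FinalStateConjecture.FinalStateConjecture.Theorems.ExactKerrEnds

universe u

variable {n : ℕ} {X : Type u} [TopologicalSpace X] [ChartedSpace (EuclideanSpace ℝ (Fin n)) X]
  [IsManifold (𝓡 n) ∞ X] [ConnectedSpace X] {D : InitialDataSet (𝓡 n) X}

/-- **Exact-region chart from a maximal development of the sub-datum, with leaf matching and
injectivity.** For a vacuum Cauchy development `𝒟` of `D` on `X`, a smooth open embedding
`φ : N → X` with injective differentials of a connected nonempty `N` with compact complement
`(range φ)ᶜ`, a MAXIMAL vacuum Cauchy development `𝒦` of `D.comap φ` and a smooth isometric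
immersion `ε : 𝒦 → 𝓣`: there are an open `E' ⊇ J⁺(ιX) ∖ J⁺(ι (range φ)ᶜ)` and `χ : 𝒟 → 𝓣`, smooth
on `E'`, with `χ^* g_𝓣 = g_𝒟` on `E'`, time-orientation preserving on `E'` if `ε` is, with
`ι (φ u) ∈ E'` and `χ (ι (φ u)) = ε (ι_𝒦 u)` for every `u : N`, and injective on `E'` if `ε` is
injective. (`E'` is the domain-of-dependence component of `ι(range φ)`; `χ = ε ∘ ψ` with `ψ` the
open embedding of the sub-data development `𝒟.comapAlongRestrict φ E'` into `𝒦` given by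
maximality, `ψ ∘ ι ∘ φ = ι_𝒦`.) Adapted from `exactRegionCore_of_leafMaximal`.
[cite: ChoquetBruhatGeroch1969CMP, Thm. 3 and p. 332; Sbierski2016AHP, Def. 2.4 and Def. 2.5] -/
theorem exactRegionChart_of_leafMaximal (𝒟 : VacuumCauchyDevelopment D) {N : Type u}
    [TopologicalSpace N] [ChartedSpace (EuclideanSpace ℝ (Fin n)) N] [IsManifold (𝓡 n) ∞ N]
    [ConnectedSpace N] [Nonempty N] {φ : N → X} (hφ : ContMDiff (𝓡 n) (𝓡 n) (∞ + 1) φ)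
    (hφ' : ∀ u, Injective (mfderiv (𝓡 n) (𝓡 n) φ u)) (hφo : IsOpenEmbedding φ)
    (hK : IsCompact (range φ)ᶜ) (𝒦 : VacuumCauchyDevelopment (D.comap φ hφ hφ'))
    (h𝒦 : 𝒦.IsMaximal) (𝓣 : Spacetime.{u} (n + 1)) (ε : 𝒦.carrier → 𝓣.carrier)
    (hε : ContMDiff (𝓡 (n + 1)) (𝓡 (n + 1)) ∞ ε)
    (hεi : ∀ p, pullbackBilin (I := 𝓡 (n + 1)) (I' := 𝓡 (n + 1)) ε 𝓣.metric.val p = 𝒦.metric.val p) :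
    ∃ (E' : Set 𝒟.carrier) (χ : 𝒟.carrier → 𝓣.carrier),
      (𝒟.metric.causalFuture 𝒟.timeOrientation (range 𝒟.embed) \
          𝒟.metric.causalFuture 𝒟.timeOrientation (𝒟.embed '' (range φ)ᶜ)) ⊆ E' ∧
      IsOpen E' ∧ ContMDiffOn (𝓡 (n + 1)) (𝓡 (n + 1)) ∞ χ E' ∧
      (∀ p ∈ E', pullbackBilin (I := 𝓡 (n + 1)) (I' := 𝓡 (n + 1)) χ 𝓣.metric.val p =
          𝒟.metric.val p) ∧
      (𝒦.timeOrientation.PreservesTimeOrientation ε 𝓣.timeOrientation →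
        ∀ p ∈ E', 𝓣.timeOrientation.IsFutureDirected
          (mfderiv (𝓡 (n + 1)) (𝓡 (n + 1)) χ p (𝒟.timeOrientation.vectorField p))) ∧
      (∀ u : N, 𝒟.embed (φ u) ∈ E' ∧ χ (𝒟.embed (φ u)) = ε (𝒦.embed u)) ∧
      (Injective ε → InjOn χ E') := by
  classical
  obtain ⟨u₀⟩ := ‹Nonempty N›
  -- the domain-of-dependence component `V` of `ι(range φ)`
  obtain ⟨hVo, hVc, hιV, hC⟩ := isCauchyHypersurface_dodComponent 𝒟.toCauchyDevelopment hφo u₀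
  set V : Opens 𝒟.carrier := ⟨_, hVo⟩ with hV_def
  have hEV : 𝒟.metric.causalFuture 𝒟.timeOrientation (range 𝒟.embed) \
      𝒟.metric.causalFuture 𝒟.timeOrientation (𝒟.embed '' (range φ)ᶜ) ⊆ (V : Set 𝒟.carrier) :=
    exactRegion_subset_dodComponent 𝒟.toCauchyDevelopment hφo hK u₀
  -- the sub-data development `(V, g|_V, ι ∘ φ)` of `D.comap φ`
  have hν : ∀ u, MDifferentiableAt (𝓡 n) (𝓡 (n + 1)).tangent
      (fun x ↦ (TotalSpace.mk' (EuclideanSpace ℝ (Fin (n + 1))) (𝒟.embed x) (𝒟.normal x) :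
        TangentBundle (𝓡 (n + 1)) 𝒟.carrier)) (φ u) := fun u ↦
    𝒟.toDataEmbedding.mdifferentiableAt_embed_normal (φ u)
  have hC' : (𝒟.metric.restrict PseudoRiemannianMetric.contMDiff_restrict_holds V).IsCauchyHypersurface
      (𝒟.timeOrientation.restrict PseudoRiemannianMetric.contMDiff_restrict_holds
        𝒟.timeOrientation.contMDiff_restrict_holds V)
      (range ((𝒟.toDataEmbedding.comapAlong φ hφ hφ' hφo hν).embedOpens V hιV)) := by
    intro γ s hγ
    obtain ⟨t, ⟨hts, u, hu⟩, huniq⟩ := hC γ s hγ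
    refine ⟨t, ⟨hts, u, Subtype.ext hu⟩, fun t' ht' ↦ huniq t' ⟨ht'.1, ?_⟩⟩
    obtain ⟨u', hu'⟩ := ht'.2
    exact ⟨u', congrArg Subtype.val hu'⟩
  set R : VacuumCauchyDevelopment (D.comap φ hφ hφ') :=
    𝒟.comapAlongRestrict φ hφ hφ' hφo hν V hVc hιV hC' with hR_def
  -- maximality of `𝒦`: the open embedding `ψ : V → 𝒦` over the data
  obtain ⟨ψ, hψs, hψo, hψi, hψτ, hψe⟩ := h𝒦 R
  -- `χ := ε ∘ ψ` on `V`
  set t₀ : 𝓣.carrier := ε (ψ (R.embed u₀)) with ht₀_def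
  set χ : 𝒟.carrier → 𝓣.carrier := fun p ↦
    if h : p ∈ (V : Set 𝒟.carrier) then ε (ψ ⟨p, h⟩) else t₀ with hχ_def
  have hχV : (fun x : V ↦ χ x) = ε ∘ ψ := by
    funext x
    simp only [hχ_def, Function.comp_apply, Subtype.coe_prop, dif_pos, Subtype.coe_eta]
  have hεψ : ContMDiff (𝓡 (n + 1)) (𝓡 (n + 1)) ∞ (ε ∘ ψ) := hε.comp hψs
  -- smoothness on `V`: `χ ∘ (V ↪ M) = ε ∘ ψ`
  have hχat : ∀ p (hp : p ∈ (V : Set 𝒟.carrier)), ContMDiffAt (𝓡 (n + 1)) (𝓡 (n + 1)) ∞ χ p := by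
    intro p hp
    have h : ContMDiffAt (𝓡 (n + 1)) (𝓡 (n + 1)) ∞ (fun x : V ↦ χ x) ⟨p, hp⟩ := by
      rw [hχV]
      exact hεψ.contMDiffAt
    exact contMDiffAt_subtype_iff.mp h
  -- the differential on `V`: `dχ_p = d(ε ∘ ψ)_⟨p, hp⟩ = dε ∘ dψ`
  have hdχ : ∀ p (hp : p ∈ (V : Set 𝒟.carrier)), mfderiv (𝓡 (n + 1)) (𝓡 (n + 1)) χ p =
      (mfderiv (𝓡 (n + 1)) (𝓡 (n + 1)) ε (ψ ⟨p, hp⟩)).comp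
        (mfderiv (𝓡 (n + 1)) (𝓡 (n + 1)) ψ (⟨p, hp⟩ : R.carrier)) := by
    intro p hp
    have hdiff : MDifferentiableAt (𝓡 (n + 1)) (𝓡 (n + 1)) χ p :=
      (hχat p hp).mdifferentiableAt (by simp)
    have hd1 : mfderiv (𝓡 (n + 1)) (𝓡 (n + 1)) χ p =
        mfderiv (𝓡 (n + 1)) (𝓡 (n + 1)) (χ ∘ Subtype.val : V → 𝓣.carrier) ⟨p, hp⟩ :=
      (mfderiv_comp_subtypeVal (W := V) (y := ⟨p, hp⟩) hdiff).symm
    have hd2 : mfderiv (𝓡 (n + 1)) (𝓡 (n + 1)) (χ ∘ Subtype.val : V → 𝓣.carrier) ⟨p, hp⟩ =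
        mfderiv (𝓡 (n + 1)) (𝓡 (n + 1)) (ε ∘ ψ) (⟨p, hp⟩ : R.carrier) := by
      rw [show (χ ∘ Subtype.val : V → 𝓣.carrier) = ε ∘ ψ from hχV]
      rfl
    have hd3 : mfderiv (𝓡 (n + 1)) (𝓡 (n + 1)) (ε ∘ ψ) (⟨p, hp⟩ : R.carrier) =
        (mfderiv (𝓡 (n + 1)) (𝓡 (n + 1)) ε (ψ ⟨p, hp⟩)).comp
          (mfderiv (𝓡 (n + 1)) (𝓡 (n + 1)) ψ (⟨p, hp⟩ : R.carrier)) :=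
      mfderiv_comp _ (hε.mdifferentiableAt (by simp)) (hψs.mdifferentiableAt (by simp))
    exact hd1.trans (hd2.trans hd3)
  have hχp : ∀ p (hp : p ∈ (V : Set 𝒟.carrier)), χ p = ε (ψ ⟨p, hp⟩) := fun p hp ↦ by
    simp only [hχ_def, dif_pos hp]
  refine ⟨V, χ, hEV, V.isOpen, fun p hp ↦ (hχat p hp).contMDiffWithinAt, fun p hp ↦ ?_,
    fun hετ p hp ↦ ?_, fun u ↦ ⟨hιV u, ?_⟩, fun hεinj p hp q hq hpq ↦ ?_⟩
  · -- the pullback on `V`: `χ^* g_𝓣 = ψ^* (ε^* g_𝓣) = ψ^* g_𝒦 = g|_V`, read on vectors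
    have hψp := hψi.2 (⟨p, hp⟩ : R.carrier)
    have hεp := hεi (ψ ⟨p, hp⟩)
    ext v w
    have e1 : pullbackBilin (I := 𝓡 (n + 1)) (I' := 𝓡 (n + 1)) χ 𝓣.metric.val p v w =
        𝓣.metric.val (ε (ψ ⟨p, hp⟩))
          (mfderiv (𝓡 (n + 1)) (𝓡 (n + 1)) ε (ψ ⟨p, hp⟩)
            (mfderiv (𝓡 (n + 1)) (𝓡 (n + 1)) ψ (⟨p, hp⟩ : R.carrier) v))
          (mfderiv (𝓡 (n + 1)) (𝓡 (n + 1)) ε (ψ ⟨p, hp⟩)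
            (mfderiv (𝓡 (n + 1)) (𝓡 (n + 1)) ψ (⟨p, hp⟩ : R.carrier) w)) := by
      rw [pullbackBilin_apply, hχp p hp, hdχ p hp]
      rfl
    have e2 : 𝓣.metric.val (ε (ψ ⟨p, hp⟩))
          (mfderiv (𝓡 (n + 1)) (𝓡 (n + 1)) ε (ψ ⟨p, hp⟩)
            (mfderiv (𝓡 (n + 1)) (𝓡 (n + 1)) ψ (⟨p, hp⟩ : R.carrier) v))
          (mfderiv (𝓡 (n + 1)) (𝓡 (n + 1)) ε (ψ ⟨p, hp⟩)
            (mfderiv (𝓡 (n + 1)) (𝓡 (n + 1)) ψ (⟨p, hp⟩ : R.carrier) w)) =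
        𝒦.metric.val (ψ ⟨p, hp⟩) (mfderiv (𝓡 (n + 1)) (𝓡 (n + 1)) ψ (⟨p, hp⟩ : R.carrier) v)
          (mfderiv (𝓡 (n + 1)) (𝓡 (n + 1)) ψ (⟨p, hp⟩ : R.carrier) w) := by
      have := congrArg (fun B ↦ B (mfderiv (𝓡 (n + 1)) (𝓡 (n + 1)) ψ (⟨p, hp⟩ : R.carrier) v)
        (mfderiv (𝓡 (n + 1)) (𝓡 (n + 1)) ψ (⟨p, hp⟩ : R.carrier) w)) hεp
      simpa only [pullbackBilin_apply] using this
    have e3 : 𝒦.metric.val (ψ ⟨p, hp⟩) (mfderiv (𝓡 (n + 1)) (𝓡 (n + 1)) ψ (⟨p, hp⟩ : R.carrier) v)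
          (mfderiv (𝓡 (n + 1)) (𝓡 (n + 1)) ψ (⟨p, hp⟩ : R.carrier) w) =
        R.metric.val (⟨p, hp⟩ : R.carrier) v w := by
      have := congrArg (fun B ↦ B v w) hψp
      simpa only [pullbackBilin_apply] using this
    rw [e1, e2, e3]
    rfl
  · -- the time orientation on `V`: `dχ T = dε (dψ T)`, `dψ T` future (ψ preserves), `dε` of a
    -- future vector future (pointwise timecone lemma at `ψ ⟨p, hp⟩`)
    have h1 : 𝒦.timeOrientation.IsFutureDirected
        (mfderiv (𝓡 (n + 1)) (𝓡 (n + 1)) ψ (⟨p, hp⟩ : R.carrier)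
          (R.timeOrientation.vectorField (⟨p, hp⟩ : R.carrier))) := hψτ ⟨p, hp⟩
    have h2 := TimeOrientation.isFutureDirected_mfderiv_at (τ := 𝓣.timeOrientation)
      (τN := 𝒦.timeOrientation) (hετ (ψ ⟨p, hp⟩)) (hεi (ψ ⟨p, hp⟩)) h1
    rw [hdχ p hp, hχp p hp]
    exact h2
  · -- leaf matching: `χ (ι (φ u)) = ε (ψ (ι_R u)) = ε (ι_𝒦 u)` since `ψ ∘ ι_R = ι_𝒦`
    have hRu : (⟨𝒟.embed (φ u), hιV u⟩ : R.carrier) = R.embed u := rfl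
    rw [hχp _ (hιV u), hRu, show ψ (R.embed u) = (ψ ∘ R.embed) u from rfl, hψe]
  · -- injectivity on `V`: `ε` injective, `ψ` an open embedding
    rw [hχp p hp, hχp q hq] at hpq
    exact congrArg Subtype.val (hψo.injective (hεinj hpq))


/-! ### The Kerr-ended case: `ExactKerrFarDevelopment` from far-leaf maximality -/

section KerrEnded

/-- **Injectivity of `dφ` at a point where `φ^*h = ψ^*g_{M,a}`** and `ψ` is a spacelike immersion
into the Kerr chart: `h(dφ v, dφ v) = g_{M,a}(dψ v, dψ v) > 0` for `v ≠ 0`. [folklore] -/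
theorem injective_mfderiv_of_h_eq [Kerr.Facts] {S : Type*} [TopologicalSpace S]
    [ChartedSpace E3 S] {Y : Type*} [TopologicalSpace Y] [ChartedSpace E3 Y]
    [IsManifold (𝓡 3) ∞ Y] (D' : InitialDataSet (𝓡 3) Y) {M a r₀ : ℝ} {f : S → Y}
    {ψ : S → Kerr.region a r₀} (hsp : (Kerr.smoothMetric M a r₀).IsSpacelikeImmersion 𝓘(ℝ, E3) ψ)
    {u : S} (hh : ∀ v w : E3,
      D'.h.inner (f u) (mfderiv 𝓘(ℝ, E3) (𝓡 3) f u v) (mfderiv 𝓘(ℝ, E3) (𝓡 3) f u w) =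
        Kerr.bilin M a (ψ u : E4) (mfderiv 𝓘(ℝ, E3) 𝓘(ℝ, E4) ψ u v)
          (mfderiv 𝓘(ℝ, E3) 𝓘(ℝ, E4) ψ u w)) :
    Injective (mfderiv (𝓡 3) (𝓡 3) f u) := by
  refine (injective_iff_map_eq_zero _).mpr fun v hv ↦ ?_
  by_contra hne
  have hpos := hsp.inducedBilin_pos u hne
  rw [PseudoRiemannianMetric.inducedBilin_apply] at hpos
  have key : D'.h.inner (f u) (mfderiv 𝓘(ℝ, E3) (𝓡 3) f u v) (mfderiv 𝓘(ℝ, E3) (𝓡 3) f u v) =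
      (Kerr.smoothMetric M a r₀).val (ψ u) (mfderiv 𝓘(ℝ, E3) 𝓘(ℝ, E4) ψ u v)
        (mfderiv 𝓘(ℝ, E3) 𝓘(ℝ, E4) ψ u v) := hh v v
  have hv' : mfderiv 𝓘(ℝ, E3) (𝓡 3) f u v = 0 := hv
  rw [hv', map_zero] at key
  exact (ne_of_lt hpos) key

/-- **`ExactKerrFarDevelopment` from far-leaf maximality** (conditional reduction of the support
item stmt-FinalStateConjecture-18523 of route `ExactKerrEnds`). HYPOTHESIS (displayed; the one
ingredient the tree cannot certify — Choquet-Bruhat–Geroch 1969, Thm. 3 applied to Kerr together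
with local geometric uniqueness, Hawking–Ellis 1973, §7.5–7.6): for exact Kerr end data
`(K, U, M, a, r₀, φ, ψ, ν)` of an admissible datum `D` there are a compact `K' ⊇ K` and an open
`N ⊆ U`, connected, which is exactly the far piece `{y ∈ U | φ y ∉ K'}`, such that the pulled-back
far-leaf datum `D.comap (φ ∘ incl)` has a MAXIMAL vacuum Cauchy development `𝒦` carried by the
same Kerr chart: a smooth INJECTIVE isometric time-orientation preserving
`ε : 𝒦 → Kerr.spacetime M a r₀` extending the leaf, `ε ∘ ι_𝒦 = ψ ∘ incl` (the domain of
dependence of the far leaf in `{r > r₀}` is the maximal development of its data). CONCLUSION: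
`ExactKerrFarDevelopment` — for every maximal vacuum Cauchy development `𝒟` of `D` the exact part
`J⁺(ιX) ∖ J⁺(ιK')` is charted smoothly, injectively, isometrically and time-orientably into
`Kerr.region a r₀` by a `χ` with `χ (ι (φ y)) = ψ y` off `K'` (`exactRegionChart_of_leafMaximal`
for `φ ∘ incl : N → X`, whose range has complement `K'`).
[cite: ChoquetBruhatGeroch1969CMP, Thm. 3 and p. 332; HawkingEllis1973CUP, §7.6 (pp. 249–251)] -/
theorem exactKerrFarDevelopment_of_farLeafMaximal
    (hF : ∀ (X : Type) [TopologicalSpace X] [ChartedSpace E3 X]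
      [IsManifold (𝓡 3) ((⊤ : ℕ∞) : WithTop ℕ∞) X] [T2Space X] [SecondCountableTopology X]
      [ConnectedSpace X], ∀ [Kerr.Facts], ∀ D ∈ admissibleVacuumData X,
      ∀ (K : Set X) (U : Opens E3) (M a r₀ : ℝ) (hM : 0 ≤ M) (φ : U → X)
        (ψ : U → Kerr.region a r₀) (ν : NormalField 𝓘(ℝ, E4) ψ),
      D.IsExactKerrEndAlong K U M a r₀ hM φ ψ ν →
      ∃ (K' : Set X) (N : Opens E3) (hNU : N ≤ U), IsCompact K' ∧ K ⊆ K' ∧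
        IsConnected (N : Set E3) ∧ (∀ y : U, (y : E3) ∈ N ↔ φ y ∉ K') ∧
        ∀ [ConnectedSpace N] (hφN : ContMDiff (𝓡 3) (𝓡 3) (∞ + 1) (φ ∘ Opens.inclusion hNU))
          (hφN' : ∀ u, Injective (mfderiv (𝓡 3) (𝓡 3) (φ ∘ Opens.inclusion hNU) u)),
          ∃ 𝒦 : VacuumCauchyDevelopment (D.comap (φ ∘ Opens.inclusion hNU) hφN hφN'),
            𝒦.IsMaximal ∧ ∃ ε : 𝒦.carrier → (Kerr.spacetime M a r₀ hM).carrier,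
              ContMDiff (𝓡 4) (𝓡 4) ∞ ε ∧ Injective ε ∧
              (∀ p, pullbackBilin (I := 𝓡 4) (I' := 𝓡 4) ε
                (Kerr.spacetime M a r₀ hM).metric.val p = 𝒦.metric.val p) ∧
              𝒦.timeOrientation.PreservesTimeOrientation ε
                (Kerr.spacetime M a r₀ hM).timeOrientation ∧
              ∀ u : N, ε (𝒦.embed u) = ψ (Opens.inclusion hNU u)) :
    Summit.FinalStateConjecture.FinalStateConjecture.Theses.ExactKerrEnds.ExactKerrFarDevelopment := by
  intro X _ _ _ _ _ _ _ D hD K U M a r₀ hM φ ψ ν hKE 𝒟 h𝒟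
  -- the end data, bundled
  have hKE' : D.IsExactKerrEndAlong K U M a r₀ hM φ ψ ν := hKE
  obtain ⟨K', N, hNU, hK'c, hKK', hNc, hN, hF'⟩ := hF X D hD K U M a r₀ hM φ ψ ν hKE'
  -- the far chart `φN = φ ∘ incl : N → X`
  haveI : ConnectedSpace N := isConnected_iff_connectedSpace.mp hNc
  haveI : Nonempty N := hNc.nonempty.to_subtype
  set φN : N → X := φ ∘ Opens.inclusion hNU with hφN_def
  have hφs : ContMDiff (𝓡 3) (𝓡 3) ∞ φ := hKE'.contMDiff
  have hφN : ContMDiff (𝓡 3) (𝓡 3) (∞ + 1) φN := hφs.comp (contMDiff_inclusion hNU)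
  -- off `K'` (so off `K`) the pull-back identity holds, hence `dφ` is injective there
  have hNK : ∀ u : N, φ (Opens.inclusion hNU u) ∉ K := fun u hu ↦
    ((hN (Opens.inclusion hNU u)).mp u.2) (hKK' hu)
  have hφN' : ∀ u, Injective (mfderiv (𝓡 3) (𝓡 3) φN u) := by
    intro u
    rw [hφN_def, mfderiv_comp_inclusion hNU (hφs.mdifferentiableAt (by simp))]
    exact injective_mfderiv_of_h_eq D hKE'.isSpacelikeImmersion
      fun v w ↦ hKE'.h_eq (Opens.inclusion hNU u) v w (hNK u)
  have hφNo : IsOpenEmbedding φN :=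
    hKE'.isOpenEmbedding.comp (Opens.isOpenEmbedding_of_le hNU)
  -- the range of the far chart is exactly `X ∖ K'`
  have hrange : range φN = K'ᶜ := by
    ext x
    constructor
    · rintro ⟨u, rfl⟩
      exact (hN (Opens.inclusion hNU u)).mp u.2
    · intro hx
      have hxK : x ∈ Kᶜ := fun h ↦ hx (hKK' h)
      obtain ⟨y, rfl⟩ := hKE'.compl_subset_range hxK
      exact ⟨⟨(y : E3), (hN y).mpr hx⟩, rfl⟩
  have hKN : IsCompact (range φN)ᶜ := by
    rw [hrange, compl_compl]
    exact hK'c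
  -- far-leaf maximality
  obtain ⟨𝒦, h𝒦, ε, hε, hεinj, hεi, hετ, hεψ⟩ := hF' hφN hφN'
  obtain ⟨E', χ, hE, hEo, hχs, hχi, hχτ, hχleaf, hχinj⟩ :=
    exactRegionChart_of_leafMaximal 𝒟 hφN hφN' hφNo hKN 𝒦 h𝒦 (Kerr.spacetime M a r₀ hM) ε hε hεi
  refine ⟨K', E', χ, hK'c, hKK', ?_, hEo, hχs, hχinj hεinj, fun p hp ↦ ⟨fun v w ↦ ?_, hχτ hετ p hp⟩,
    fun y hy ↦ ?_⟩
  · -- the exact part of `K'` is the exact part of `(range φN)ᶜ = K'`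
    rw [hrange, compl_compl] at hE
    exact hE
  · -- the isometry, read on vectors
    have h := congrArg (fun B ↦ B v w) (hχi p hp)
    rw [pullbackBilin_apply] at h
    exact h
  · -- the leaf: `y = incl u` with `u = ⟨y, _⟩ : N`
    have hu : (y : E3) ∈ N := (hN y).mpr hy
    obtain ⟨hmem, hval⟩ := hχleaf ⟨(y : E3), hu⟩
    have hyu : Opens.inclusion hNU ⟨(y : E3), hu⟩ = y := Subtype.ext rfl
    refine ⟨?_, ?_⟩
    · simpa only [hφN_def, Function.comp_apply, hyu] using hmem
    · have h2 := hεψ ⟨(y : E3), hu⟩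
      rw [hyu] at h2
      have h3 := hval.trans h2
      have h4 : φN ⟨(y : E3), hu⟩ = φ y := by simp only [hφN_def, Function.comp_apply, hyu]
      rw [h4] at h3
      exact h3

end KerrEnded

end Summit.FinalStateConjecture.FinalStateConjecture.Theorems.ExactKerrEnds

end
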